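import Summits.QuantumFields.YangMills.Theorems.BalabanUVNodesPortS1ChartBlindSharp
import Summits.QuantumFields.YangMills.Theorems.BalabanUVNodesN09CentralWindowJacobianGraphContinuous

/-!
# NODE O port PT-A — FE-1's chart law (T1), brick (b1) of ★★★ №691 (2)(b): THE BLIND SHARP BUNDLE OF THE CENTRAL α-WINDOW WITH ITS JACOBIAN AND INVERSE DENSITY JOINTLY CONTINUOUS —
# ✓`…PortS1ChartBlindSharp` §2 re-derived from a forward density that is JOINTLY continuous on the window graph (dag-n09-w6 ✓`exists_jacobian_forwardLaws_continuousOn_graph`), the two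
# extra clauses `∀ c, ContinuousOn (jac′ c · ·) {window graph}` and `∀ c, ContinuousOn (jd c · ·) {T-graph}` threaded through the blind-ification `U ↦ extend β 1 U` — the chart-regularity input
# (`hJV`-type joint continuity of `J = 𝟙·Π jd`) of dag-n09's `hgc` road ✓`…N09ChartRegularityOfJointContinuity` ∕ ✓`…N09FibreIntegralContinuousOfChartRegularity` ([I] p.259 «analytic in U_{k+1}»)

Cell `ym-nodeO-ideate`, porter seat PT-A-1 (gen 14); `--kind proof --supports stmt-QuantumFields-27930 --as helper`; count-neutral.  [I] = [Balaban1987RG1].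
Written by PT-A g14 under ★★★ №692 FREEZE (D-0186) as INTENT-PTA-28; ◆ CRIT-1 g42 J41 cut 2026-09-01; filed by PT-A g15 on ★★★'s №692 (2)∕№698∕№699 word («PTA-26 (b)»), docblock line only changed.
Adapted from ✓`…PortS1ChartBlindSharp` §2–§3 (PT-A g10): the proof is that proof with the joint-continuity clause carried; nothing else changes.

WHAT IS PROVED (0 `def`, 0 `sorry`).  ★★★ `exists_blindSharpPerBondCharts_centralWindow_graph` (input: a forward density with N09's four clauses + JOINT continuity on the window graph; output:
the 26 clauses of ✓`exists_blindSharpPerBondCharts_centralWindow` + (27) `jac′` jointly continuous on the window graph + (28) `jd` jointly continuous on the `T`-graph) · ★★★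
`exists_blindSharpPerBondCharts_centralWindow_record_graph` (at the record: fed by ✓`exists_jacobian_forwardLaws_continuousOn_graph`; `k < K`, `0 ≤ α ≤ 1∕24`, `64α ≤ δ_N`,
`157α < L^{−(d−1)}`, `offCard∕|Idx| + 150α < 1`).

HONEST FRAMING.  Topology by name (composition of continuous maps, `inv₀` away from zero); no Bałaban estimate; the `hgc` itself is dag-n09's theorem modulo ITS rows; (B-T2) NOT here;
`FEChartLawReg`∕`FEPolymerActivitiesReg`∕`P0HolExtAtRecordGL`∕`ClassP2Reg`∕`RegSelSmoothOnClass`∕`RegClassNestsUc` inhabited NOWHERE; ⟨27930⟩ OPEN 2∕7 · no claim; NODE O 0∕1; COUNT 8∕28 · K 1∕4 ·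
legs 0∕6 UNMOVED; finite `𝕋⁴_{L^K}` at fixed ε — NOT continuum ∕ OS; **the Yang–Mills mass gap (Clay) is NOT proved by any of this.**  No `sorry`, no `def`, no `instance`; standard axioms only.
-/

noncomputable section

open MeasureTheory ProbabilityTheory Set Function Filter Topology
open scoped ENNReal NNReal BigOperators

namespace Summit.QuantumFields.YangMills.Theorems.BalabanUVNodesPortS1

open Literature.MathematicalPhysics.QuantumFieldTheory.Balaban1983to89
open Literature.MathematicalPhysics.QuantumFieldTheory.Balaban1983to89.T4AveragingDisintegration
open Literature.MathematicalPhysics.QuantumFieldTheory.Balaban1983to89.BlockAveraging (Small Idx avgFun loopHol)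
open Literature.MathematicalPhysics.QuantumFieldTheory.Balaban1983to89.BlockAveragingHaarAC (centralBond pre post centralBond_injective isLocal_avgFun)
open Literature.MathematicalPhysics.QuantumFieldTheory.Balaban1983to89.BlockAveragingEMLHaarAC (fibreFamily offCard)
open Literature.MathematicalPhysics.QuantumFieldTheory.Balaban1983to89.ExpMeanLog (expMeanLogSU deltaSU)
open Summit.QuantumFields.YangMills.Theorems.BalabanUVNodesN11TransportOfRecordInPrivateCoordinateChart (succ_le_m_add_K)
open Summit.QuantumFields.YangMills.BalabanUVNodes.N09CentralWindowAtRecord (measurableSet_centralWindow centralWindow_extend avgFun_update_centralBond_injOn_centralWindow)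
open Summit.QuantumFields.YangMills.BalabanUVNodes.N09PerBondChartsOfForwardLawsSharp (exists_perBondCharts_of_forwardLaws_sharp continuousOn_inverseDensity_of_formula)
open Summit.QuantumFields.YangMills.BalabanUVNodes.N09CentralWindowInverseContinuous
  (isClosed_imageWindowGraph_record continuousOn_inverse_of_leftInverse_record continuousOn_triChart_of_leftInverse_record isCompact_imageWindow_record)
open Summit.QuantumFields.YangMills.BalabanUVNodes.N09CentralWindowJacobianGraphContinuous (exists_jacobian_forwardLaws_continuousOn_graph)
open Node00 hiding SU
open T4Continuum

section Sharp

variable {F : T4Family} {N : ℕ} [NeZero N] {K k : ℕ}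

/-- ★★★ **THE BLIND SHARP PER-BOND BUNDLE WITH JOINTLY CONTINUOUS JACOBIAN AND INVERSE DENSITY** — ✓`exists_blindSharpPerBondCharts_centralWindow` with the input forward density assumed
JOINTLY continuous on the window graph `{(U, g) | g ∈ Ω_α(U)}` and two more output clauses: (27) `jac′` jointly continuous on the window graph, (28) `jd` jointly continuous on the `T`-graph
`{(U, v) | v ∈ T_c(U)}` (`jd = (jac′ ∘ ϑ)⁻¹`, `ϑ` jointly continuous there by dag-n09-w6's `continuousOn_inverse_of_leftInverse_record`, `jac′ ≠ 0` on the window).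
[cite: Balaban1987RG1, p.259, (0.4) p.253, (2.9)–(2.10) pp.266–267; Kechris1995, Thm 15.1; BourbakiGT1, Ch. I §10 no. 2, Thm 1 Cor. 5] -/
theorem exists_blindSharpPerBondCharts_centralWindow_graph (hk : k < K) {α : ℝ} (hα0 : 0 ≤ α) (hα : α ≤ 1 / 24)
    (hαδ : α < deltaSU (Fin N)) (hgap : ∀ c : PBond (F.P K) (k + 1), (offCard c : ℝ) / (Fintype.card (Idx (F.P K)) : ℝ) + 150 * α < 1)
    (jac : PBond (F.P K) (k + 1) → GaugeField (F.P K) k (SU N) → SU N → ℝ≥0)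
    (hjacm : ∀ c, Measurable fun p : GaugeField (F.P K) k (SU N) × SU N => jac c p.1 p.2)
    (hjac0 : ∀ c U g, (∀ i : Idx (F.P K), dist1 (fibreFamily U c (pre U c * g * post U c) i) ≤ α) → jac c U g ≠ 0)
    (hfwd : ∀ c U, (HaarData.haar : Measure (SU N)).restrict
        ((fun g => (avOfRecord F N K k).avg (update U (centralBond c) g) c) ''
          {g : SU N | ∀ i : Idx (F.P K), dist1 (fibreFamily U c (pre U c * g * post U c) i) ≤ α}) =
      (((HaarData.haar : Measure (SU N)).restrict {g : SU N | ∀ i : Idx (F.P K), dist1 (fibreFamily U c (pre U c * g * post U c) i) ≤ α}).withDensity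
          fun g => (jac c U g : ℝ≥0∞)).map (fun g => (avOfRecord F N K k).avg (update U (centralBond c) g) c))
    (hjacc : ∀ c U, ContinuousOn (jac c U) {g : SU N | ∀ i : Idx (F.P K), dist1 (fibreFamily U c (pre U c * g * post U c) i) ≤ α})
    (hjaccG : ∀ c, ContinuousOn (fun p : GaugeField (F.P K) k (SU N) × SU N => jac c p.1 p.2)
      {p : GaugeField (F.P K) k (SU N) × SU N | ∀ i : Idx (F.P K), dist1 (fibreFamily p.1 c (pre p.1 c * p.2 * post p.1 c) i) ≤ α}) :
    ∃ (T : PBond (F.P K) (k + 1) → GaugeField (F.P K) k (SU N) → Set (SU N))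
      (ϑ : PBond (F.P K) (k + 1) → GaugeField (F.P K) k (SU N) → SU N → SU N)
      (jd jac' : PBond (F.P K) (k + 1) → GaugeField (F.P K) k (SU N) → SU N → ℝ≥0),
      (∀ c, MeasurableSet {p : GaugeField (F.P K) k (SU N) × SU N | p.2 ∈ T c p.1}) ∧
      (∀ c, Measurable fun p : GaugeField (F.P K) k (SU N) × SU N => ϑ c p.1 p.2) ∧
      (∀ c, Measurable fun p : GaugeField (F.P K) k (SU N) × SU N => jd c p.1 p.2) ∧
      (∀ c U, ∀ v ∈ T c U, (avOfRecord F N K k).avg (update U (centralBond c) (ϑ c U v)) c = v) ∧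
      (∀ c U, (HaarData.haar : Measure (SU N)).restrict {g : SU N | ∀ i : Idx (F.P K), dist1 (fibreFamily U c (pre U c * g * post U c) i) ≤ α} =
        (((HaarData.haar : Measure (SU N)).restrict (T c U)).withDensity fun v => (jd c U v : ℝ≥0∞)).map (ϑ c U)) ∧
      (∀ c U, T c U = (fun g => (avOfRecord F N K k).avg (update U (centralBond c) g) c) ''
          {g : SU N | ∀ i : Idx (F.P K), dist1 (fibreFamily U c (pre U c * g * post U c) i) ≤ α}) ∧
      (∀ c U g, (∀ i : Idx (F.P K), dist1 (fibreFamily U c (pre U c * g * post U c) i) ≤ α) →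
          ϑ c U ((avOfRecord F N K k).avg (update U (centralBond c) g) c) = g) ∧
      (∀ c U, ∀ v ∈ T c U, ∀ i : Idx (F.P K), dist1 (fibreFamily U c (pre U c * ϑ c U v * post U c) i) ≤ α) ∧
      (∀ c U v, jd c U v = (jac' c U (ϑ c U v))⁻¹) ∧
      (∀ c U, ∀ v ∈ T c U, jd c U v ≠ 0) ∧
      (∀ c, Measurable fun p : GaugeField (F.P K) k (SU N) × SU N => jac' c p.1 p.2) ∧
      (∀ c U g, (∀ i : Idx (F.P K), dist1 (fibreFamily U c (pre U c * g * post U c) i) ≤ α) → jac' c U g ≠ 0) ∧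
      (∀ c U, (HaarData.haar : Measure (SU N)).restrict
          ((fun g => (avOfRecord F N K k).avg (update U (centralBond c) g) c) ''
            {g : SU N | ∀ i : Idx (F.P K), dist1 (fibreFamily U c (pre U c * g * post U c) i) ≤ α}) =
        (((HaarData.haar : Measure (SU N)).restrict {g : SU N | ∀ i : Idx (F.P K), dist1 (fibreFamily U c (pre U c * g * post U c) i) ≤ α}).withDensity
            fun g => (jac' c U g : ℝ≥0∞)).map (fun g => (avOfRecord F N K k).avg (update U (centralBond c) g) c)) ∧
      (∀ c U, ContinuousOn (jac' c U) {g : SU N | ∀ i : Idx (F.P K), dist1 (fibreFamily U c (pre U c * g * post U c) i) ≤ α}) ∧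
      (∀ c, IsClosed {q : GaugeField (F.P K) k (SU N) × SU N | q.2 ∈ T c q.1}) ∧
      (∀ c, ContinuousOn (fun q : GaugeField (F.P K) k (SU N) × SU N => ϑ c q.1 q.2) {q : GaugeField (F.P K) k (SU N) × SU N | q.2 ∈ T c q.1}) ∧
      ContinuousOn (fun p : (PBond (F.P K) (k + 1) → SU N) × GaugeField (F.P K) k (SU N) =>
          (extend centralBond (fun c => ϑ c p.2 (p.1 c)) p.2 : GaugeField (F.P K) k (SU N)))
        {p : (PBond (F.P K) (k + 1) → SU N) × GaugeField (F.P K) k (SU N) | ∀ c, p.1 c ∈ T c p.2} ∧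
      (∀ c U, IsCompact (T c U)) ∧
      (∀ c U, ContinuousOn (jd c U) (T c U)) ∧
      (∀ c U (g : PBond (F.P K) (k + 1) → SU N), T c (extend centralBond g U) = T c U) ∧
      (∀ c U (g : PBond (F.P K) (k + 1) → SU N), ϑ c (extend centralBond g U) = ϑ c U) ∧
      (∀ c U (g : PBond (F.P K) (k + 1) → SU N), jd c (extend centralBond g U) = jd c U) ∧
      (∀ c U (g : PBond (F.P K) (k + 1) → SU N), jac' c (extend centralBond g U) = jac' c U) ∧
      (∀ c, ContinuousOn (fun p : GaugeField (F.P K) k (SU N) × SU N => jac' c p.1 p.2)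
        {p : GaugeField (F.P K) k (SU N) × SU N | ∀ i : Idx (F.P K), dist1 (fibreFamily p.1 c (pre p.1 c * p.2 * post p.1 c) i) ≤ α}) ∧
      (∀ c, ContinuousOn (fun q : GaugeField (F.P K) k (SU N) × SU N => jd c q.1 q.2) {q : GaugeField (F.P K) k (SU N) × SU N | q.2 ∈ T c q.1}) := by
  have hkr : k + 1 ≤ (F.P K).m + (F.P K).K := succ_le_m_add_K hk
  have hβ : Injective (centralBond : PBond (F.P K) (k + 1) → PBond (F.P K) k) := centralBond_injective hkr
  -- the resampling with the private datum `1`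
  set e : GaugeField (F.P K) k (SU N) → GaugeField (F.P K) k (SU N) := fun U => extend centralBond (1 : PBond (F.P K) (k + 1) → SU N) U with he
  have hem : Measurable e := measurable_extend_const hβ _
  have hee : ∀ (U : GaugeField (F.P K) k (SU N)) (g : PBond (F.P K) (k + 1) → SU N), e (extend centralBond g U) = e U :=
    fun U g => extend_extend_eq_extend hβ U _ g
  have hee1 : ∀ U : GaugeField (F.P K) k (SU N), e (e U) = e U := fun U => hee U 1
  have hmap : ∀ (c : PBond (F.P K) (k + 1)) (U : GaugeField (F.P K) k (SU N)) (x : SU N),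
      (avOfRecord F N K k).avg (update (e U) (centralBond c) x) c = (avOfRecord F N K k).avg (update U (centralBond c) x) c :=
    fun c U x => avg_update_centralBond_extend hk U c 1 x
  have hwin : ∀ (c : PBond (F.P K) (k + 1)) (U : GaugeField (F.P K) k (SU N)) (g : SU N),
      (∀ i : Idx (F.P K), dist1 (fibreFamily (e U) c (pre (e U) c * g * post (e U) c) i) ≤ α) ↔
        ∀ i : Idx (F.P K), dist1 (fibreFamily U c (pre U c * g * post U c) i) ≤ α :=
    fun c U g => centralWindow_mem_iff_extend hk c α U 1 g
  have hwinset : ∀ (c : PBond (F.P K) (k + 1)) (U : GaugeField (F.P K) k (SU N)),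
      {g : SU N | ∀ i : Idx (F.P K), dist1 (fibreFamily (e U) c (pre (e U) c * g * post (e U) c) i) ≤ α} =
        {g : SU N | ∀ i : Idx (F.P K), dist1 (fibreFamily U c (pre U c * g * post U c) i) ≤ α} :=
    fun c U => centralWindow_extend (N := N) hkr c α U 1
  have hpm : Measurable fun p : GaugeField (F.P K) k (SU N) × SU N => (e p.1, p.2) := (hem.comp measurable_fst).prodMk measurable_snd
  -- the blind forward density
  set jac' : PBond (F.P K) (k + 1) → GaugeField (F.P K) k (SU N) → SU N → ℝ≥0 := fun c U => jac c (e U) with hjac'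
  have hjacm' : ∀ c, Measurable fun p : GaugeField (F.P K) k (SU N) × SU N => jac' c p.1 p.2 := fun c => (hjacm c).comp hpm
  have hjac0' : ∀ c U g, (∀ i : Idx (F.P K), dist1 (fibreFamily U c (pre U c * g * post U c) i) ≤ α) → jac' c U g ≠ 0 :=
    fun c U g hg => hjac0 c (e U) g ((hwin c U g).2 hg)
  have hfwd' : ∀ c U, (HaarData.haar : Measure (SU N)).restrict
        ((fun g => (avOfRecord F N K k).avg (update U (centralBond c) g) c) ''
          {g : SU N | ∀ i : Idx (F.P K), dist1 (fibreFamily U c (pre U c * g * post U c) i) ≤ α}) =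
      (((HaarData.haar : Measure (SU N)).restrict {g : SU N | ∀ i : Idx (F.P K), dist1 (fibreFamily U c (pre U c * g * post U c) i) ≤ α}).withDensity
          fun g => (jac' c U g : ℝ≥0∞)).map (fun g => (avOfRecord F N K k).avg (update U (centralBond c) g) c) :=
    fun c U => forwardLaw_extend hk jac hfwd c U 1
  have hjacc' : ∀ c U, ContinuousOn (jac' c U) {g : SU N | ∀ i : Idx (F.P K), dist1 (fibreFamily U c (pre U c * g * post U c) i) ≤ α} := by
    intro c U
    have h := hjacc c (e U)
    rw [hwinset c U] at h
    exact h
  -- the sharp packaging at the blind forward density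
  obtain ⟨T, ϑ, jd, -, -, hTm, hθm, hjm, hright, hlaw, hTim, hleft, hθwin, hQ, hP, -, -, -, -⟩ :=
    exists_perBondCharts_of_forwardLaws_sharp (F := F) (N := N) hk hα0 hα hαδ hgap jac' hjacm' hjac0' hfwd'
  -- blindify `(T, ϑ, jd)` by pre-composition with `e`
  have hTim' : ∀ c U, T c (e U) = (fun g => (avOfRecord F N K k).avg (update U (centralBond c) g) c) ''
      {g : SU N | ∀ i : Idx (F.P K), dist1 (fibreFamily U c (pre U c * g * post U c) i) ≤ α} := by
    intro c U
    rw [hTim c (e U), hwinset c U]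
    exact image_congr fun x _ => hmap c U x
  have hleft' : ∀ c U g, (∀ i : Idx (F.P K), dist1 (fibreFamily U c (pre U c * g * post U c) i) ≤ α) →
      ϑ c (e U) ((avOfRecord F N K k).avg (update U (centralBond c) g) c) = g := by
    intro c U g hg
    have h := hleft c (e U) g ((hwin c U g).2 hg)
    rwa [hmap c U g] at h
  refine ⟨fun c U => T c (e U), fun c U => ϑ c (e U), fun c U => jd c (e U), jac',
    fun c => (hTm c).preimage hpm, fun c => (hθm c).comp hpm, fun c => (hjm c).comp hpm,
    fun c U v hv => ?_, fun c U => ?_, hTim', hleft', fun c U v hv => ?_, fun c U v => ?_, fun c U v hv => hP c (e U) v hv,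
    hjacm', hjac0', hfwd', hjacc', ?_, ?_, ?_, ?_, ?_, fun c U g => ?_, fun c U g => ?_, fun c U g => ?_, fun c U g => ?_, ?_, ?_⟩
  · rw [← hmap c U]; exact hright c (e U) v hv
  · rw [← hwinset c U, hlaw c (e U)]
  · exact (hwin c U _).1 (hθwin c (e U) v hv)
  · show jd c (e U) v = (jac c (e U) (ϑ c (e U) v))⁻¹
    rw [hQ c (e U) v]
    show (jac c (e (e U)) (ϑ c (e U) v))⁻¹ = _
    rw [hee1]
  · exact fun c => isClosed_imageWindowGraph_record hk hαδ _ hTim' c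
  · exact fun c => continuousOn_inverse_of_leftInverse_record hk hαδ _ _ hTim' hleft' c
  · exact continuousOn_triChart_of_leftInverse_record hk hαδ _ _ hTim' hleft'
  · exact fun c U => isCompact_imageWindow_record hk hαδ _ hTim' c U
  · refine continuousOn_inverseDensity_of_formula (α := α) _ _ _ jac' (fun c U v => ?_) (fun c U v hv => (hwin c U _).1 (hθwin c (e U) v hv))
      (fun c U => (continuousOn_inverse_of_leftInverse_record hk hαδ _ _ hTim' hleft' c).comp
        (Continuous.prodMk_right U).continuousOn fun v hv => hv) hjac0' hjacc'
    show jd c (e U) v = (jac c (e U) (ϑ c (e U) v))⁻¹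
    rw [hQ c (e U) v]
    show (jac c (e (e U)) (ϑ c (e U) v))⁻¹ = _
    rw [hee1]
  · show T c (e (extend centralBond g U)) = T c (e U)
    rw [hee]
  · show ϑ c (e (extend centralBond g U)) = ϑ c (e U)
    rw [hee]
  · show jd c (e (extend centralBond g U)) = jd c (e U)
    rw [hee]
  · show jac c (e (extend centralBond g U)) = jac c (e U)
    rw [hee]
  · -- (27) the blind forward density is JOINTLY continuous on the window graph (`e` is continuous and the window is blind)
    intro c
    have hec : Continuous e := continuous_extend_const hβ _
    have hmap' : MapsTo (fun p : GaugeField (F.P K) k (SU N) × SU N => (e p.1, p.2))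
        {p : GaugeField (F.P K) k (SU N) × SU N | ∀ i : Idx (F.P K), dist1 (fibreFamily p.1 c (pre p.1 c * p.2 * post p.1 c) i) ≤ α}
        {p : GaugeField (F.P K) k (SU N) × SU N | ∀ i : Idx (F.P K), dist1 (fibreFamily p.1 c (pre p.1 c * p.2 * post p.1 c) i) ≤ α} :=
      fun p hp => (hwin c p.1 p.2).2 hp
    exact (hjaccG c).comp ((hec.comp continuous_fst).prodMk continuous_snd).continuousOn hmap'
  · -- (28) `jd` is JOINTLY continuous on the `T`-graph: `jd = (jac′ ∘ ϑ)⁻¹`, `ϑ` jointly continuous there, `jac′` jointly continuous and non-zero on the window graph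
    intro c
    have hec : Continuous e := continuous_extend_const hβ _
    have hθc := continuousOn_inverse_of_leftInverse_record hk hαδ _ _ hTim' hleft' c
    have hmapθ : MapsTo (fun q : GaugeField (F.P K) k (SU N) × SU N => (q.1, ϑ c (e q.1) q.2))
        {q : GaugeField (F.P K) k (SU N) × SU N | q.2 ∈ T c (e q.1)}
        {p : GaugeField (F.P K) k (SU N) × SU N | ∀ i : Idx (F.P K), dist1 (fibreFamily p.1 c (pre p.1 c * p.2 * post p.1 c) i) ≤ α} :=
      fun q hq => (hwin c q.1 _).1 (hθwin c (e q.1) q.2 hq)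
    have hjG : ContinuousOn (fun p : GaugeField (F.P K) k (SU N) × SU N => jac' c p.1 p.2)
        {p : GaugeField (F.P K) k (SU N) × SU N | ∀ i : Idx (F.P K), dist1 (fibreFamily p.1 c (pre p.1 c * p.2 * post p.1 c) i) ≤ α} :=
      (hjaccG c).comp ((hec.comp continuous_fst).prodMk continuous_snd).continuousOn fun p hp => (hwin c p.1 p.2).2 hp
    have hcomp : ContinuousOn (fun q : GaugeField (F.P K) k (SU N) × SU N => jac' c q.1 (ϑ c (e q.1) q.2))
        {q : GaugeField (F.P K) k (SU N) × SU N | q.2 ∈ T c (e q.1)} :=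
      hjG.comp (continuousOn_fst.prodMk hθc) hmapθ
    have hinv : ContinuousOn (fun q : GaugeField (F.P K) k (SU N) × SU N => (jac' c q.1 (ϑ c (e q.1) q.2))⁻¹)
        {q : GaugeField (F.P K) k (SU N) × SU N | q.2 ∈ T c (e q.1)} :=
      hcomp.inv₀ fun q hq => hjac0' c q.1 _ ((hwin c q.1 _).1 (hθwin c (e q.1) q.2 hq))
    refine hinv.congr fun q _ => ?_
    show jd c (e q.1) q.2 = (jac c (e q.1) (ϑ c (e q.1) q.2))⁻¹
    rw [hQ c (e q.1) q.2]
    show (jac c (e (e q.1)) (ϑ c (e q.1) q.2))⁻¹ = _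
    rw [hee1]


end Sharp

/-! ## §2  At the record: dag-n09-w6's jointly continuous forward laws plugged in -/

section Record

variable {F : T4Family} {N : ℕ} [NeZero N] {K k : ℕ}

/-- ★★★ **AT THE RECORD — THE JOINTLY CONTINUOUS BLIND SHARP CHART OF THE AVERAGING OF RECORD ON THE CENTRAL α-WINDOW, NOTHING DISPLAYED** (`k < K`, `0 ≤ α ≤ 1∕24`, `64α ≤ δ_N`,
`157α < L^{−(d−1)}`, `offCard∕|Idx| + 150α < 1`): §1 fed by dag-n09-w6's ✓`exists_jacobian_forwardLaws_continuousOn_graph` (five clauses). The 28 clauses; clause (28) is the `hJV`-type input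
of dag-n09's `hgc` road. [cite: Balaban1987RG1, p.259, (0.4) p.253, (2.9)–(2.10) pp.266–267; Kechris1995, Thm 15.1; Helgason2000, Ch. I §1 Thm. 1.14 (12)-(13) p. 96] -/
theorem exists_blindSharpPerBondCharts_centralWindow_record_graph (hk : k < K) {α : ℝ} (hα0 : 0 ≤ α) (hα : α ≤ 1 / 24) (hα64 : 64 * α ≤ deltaSU (Fin N))
    (hαL : 157 * α < (((F.P K).L : ℝ) ^ ((F.P K).d - 1))⁻¹)
    (hgap : ∀ c : PBond (F.P K) (k + 1), (offCard c : ℝ) / (Fintype.card (Idx (F.P K)) : ℝ) + 150 * α < 1) :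
    ∃ (T : PBond (F.P K) (k + 1) → GaugeField (F.P K) k (SU N) → Set (SU N))
      (ϑ : PBond (F.P K) (k + 1) → GaugeField (F.P K) k (SU N) → SU N → SU N)
      (jd jac' : PBond (F.P K) (k + 1) → GaugeField (F.P K) k (SU N) → SU N → ℝ≥0),
      (∀ c, MeasurableSet {p : GaugeField (F.P K) k (SU N) × SU N | p.2 ∈ T c p.1}) ∧
      (∀ c, Measurable fun p : GaugeField (F.P K) k (SU N) × SU N => ϑ c p.1 p.2) ∧
      (∀ c, Measurable fun p : GaugeField (F.P K) k (SU N) × SU N => jd c p.1 p.2) ∧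
      (∀ c U, ∀ v ∈ T c U, (avOfRecord F N K k).avg (update U (centralBond c) (ϑ c U v)) c = v) ∧
      (∀ c U, (HaarData.haar : Measure (SU N)).restrict {g : SU N | ∀ i : Idx (F.P K), dist1 (fibreFamily U c (pre U c * g * post U c) i) ≤ α} =
        (((HaarData.haar : Measure (SU N)).restrict (T c U)).withDensity fun v => (jd c U v : ℝ≥0∞)).map (ϑ c U)) ∧
      (∀ c U, T c U = (fun g => (avOfRecord F N K k).avg (update U (centralBond c) g) c) ''
          {g : SU N | ∀ i : Idx (F.P K), dist1 (fibreFamily U c (pre U c * g * post U c) i) ≤ α}) ∧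
      (∀ c U g, (∀ i : Idx (F.P K), dist1 (fibreFamily U c (pre U c * g * post U c) i) ≤ α) →
          ϑ c U ((avOfRecord F N K k).avg (update U (centralBond c) g) c) = g) ∧
      (∀ c U, ∀ v ∈ T c U, ∀ i : Idx (F.P K), dist1 (fibreFamily U c (pre U c * ϑ c U v * post U c) i) ≤ α) ∧
      (∀ c U v, jd c U v = (jac' c U (ϑ c U v))⁻¹) ∧
      (∀ c U, ∀ v ∈ T c U, jd c U v ≠ 0) ∧
      (∀ c, Measurable fun p : GaugeField (F.P K) k (SU N) × SU N => jac' c p.1 p.2) ∧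
      (∀ c U g, (∀ i : Idx (F.P K), dist1 (fibreFamily U c (pre U c * g * post U c) i) ≤ α) → jac' c U g ≠ 0) ∧
      (∀ c U, (HaarData.haar : Measure (SU N)).restrict
          ((fun g => (avOfRecord F N K k).avg (update U (centralBond c) g) c) ''
            {g : SU N | ∀ i : Idx (F.P K), dist1 (fibreFamily U c (pre U c * g * post U c) i) ≤ α}) =
        (((HaarData.haar : Measure (SU N)).restrict {g : SU N | ∀ i : Idx (F.P K), dist1 (fibreFamily U c (pre U c * g * post U c) i) ≤ α}).withDensity
            fun g => (jac' c U g : ℝ≥0∞)).map (fun g => (avOfRecord F N K k).avg (update U (centralBond c) g) c)) ∧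
      (∀ c U, ContinuousOn (jac' c U) {g : SU N | ∀ i : Idx (F.P K), dist1 (fibreFamily U c (pre U c * g * post U c) i) ≤ α}) ∧
      (∀ c, IsClosed {q : GaugeField (F.P K) k (SU N) × SU N | q.2 ∈ T c q.1}) ∧
      (∀ c, ContinuousOn (fun q : GaugeField (F.P K) k (SU N) × SU N => ϑ c q.1 q.2) {q : GaugeField (F.P K) k (SU N) × SU N | q.2 ∈ T c q.1}) ∧
      ContinuousOn (fun p : (PBond (F.P K) (k + 1) → SU N) × GaugeField (F.P K) k (SU N) =>
          (extend centralBond (fun c => ϑ c p.2 (p.1 c)) p.2 : GaugeField (F.P K) k (SU N)))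
        {p : (PBond (F.P K) (k + 1) → SU N) × GaugeField (F.P K) k (SU N) | ∀ c, p.1 c ∈ T c p.2} ∧
      (∀ c U, IsCompact (T c U)) ∧
      (∀ c U, ContinuousOn (jd c U) (T c U)) ∧
      (∀ c U (g : PBond (F.P K) (k + 1) → SU N), T c (extend centralBond g U) = T c U) ∧
      (∀ c U (g : PBond (F.P K) (k + 1) → SU N), ϑ c (extend centralBond g U) = ϑ c U) ∧
      (∀ c U (g : PBond (F.P K) (k + 1) → SU N), jd c (extend centralBond g U) = jd c U) ∧
      (∀ c U (g : PBond (F.P K) (k + 1) → SU N), jac' c (extend centralBond g U) = jac' c U) ∧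
      (∀ c, ContinuousOn (fun p : GaugeField (F.P K) k (SU N) × SU N => jac' c p.1 p.2)
        {p : GaugeField (F.P K) k (SU N) × SU N | ∀ i : Idx (F.P K), dist1 (fibreFamily p.1 c (pre p.1 c * p.2 * post p.1 c) i) ≤ α}) ∧
      (∀ c, ContinuousOn (fun q : GaugeField (F.P K) k (SU N) × SU N => jd c q.1 q.2) {q : GaugeField (F.P K) k (SU N) × SU N | q.2 ∈ T c q.1}) := by
  have hαδ : α < deltaSU (Fin N) := by have := ExpMeanLog.deltaSU_pos (n := Fin N); linarith
  obtain ⟨jac, hjacm, hjac0, hfwd, hjacc, hjaccG⟩ :=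
    exists_jacobian_forwardLaws_continuousOn_graph (N := N) (P := F.P K) (succ_le_m_add_K hk) hα0 hα hα64 hαL hgap
  have hfwd' : ∀ c U, (HaarData.haar : Measure (SU N)).restrict
        ((fun g => (avOfRecord F N K k).avg (update U (centralBond c) g) c) ''
          {g : SU N | ∀ i : Idx (F.P K), dist1 (fibreFamily U c (pre U c * g * post U c) i) ≤ α}) =
      (((HaarData.haar : Measure (SU N)).restrict {g : SU N | ∀ i : Idx (F.P K), dist1 (fibreFamily U c (pre U c * g * post U c) i) ≤ α}).withDensity
          fun g => (jac c U g : ℝ≥0∞)).map (fun g => (avOfRecord F N K k).avg (update U (centralBond c) g) c) := by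
    intro c U
    have h := hfwd c U
    rw [← avOfRecord_avg] at h
    exact h
  exact exists_blindSharpPerBondCharts_centralWindow_graph hk hα0 hα hαδ hgap jac hjacm hjac0 hfwd' hjacc hjaccG

end Record

end Summit.QuantumFields.YangMills.Theorems.BalabanUVNodesPortS1

end
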